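import Summits.ValiantsHypothesis.ValiantsHypothesis.Theorems.LacunarySymmetroidMatrixDescartesDoorA26WallBubblingInsertThree
import Summits.ValiantsHypothesis.ValiantsHypothesis.Theorems.LacunarySymmetroidMatrixDescartesDoorA26WallBubblingScalingLimit

/-!
# `DoorA26` / line `wall_bubbling` — the ORDER-4 OPENING THEOREM (second-order family `S + ηT₁ + η²T₂` at a quadruple zero)

HONEST FRAMING.  Object-search cell `pub-symmetroid`, crux `Theses.LacunarySymmetroid.DoorA26` (stmt-ValiantsHypothesis-19979; OPEN, typed,
never asserted).  W2 seat val-sym-door-p1 g19, file #72; def-free helper for obligation (R) of `Cruxes/DoorA26/Lines/wall_bubbling.lean`, the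
order-4 analogue of #50 `mem_twentyLocus_of_tripleZero_deriv` in the SECOND-ORDER FAMILY format forced by memo `DOOR-A26-P1G19-NO-BALANCE.md`
§7g (linear families provably cannot open an inside-type quadruple zero).  Imports #71 `…InsertThree` (frame) and #70 `…ScalingLimit` (blow-up).

THE STATEMENT.  Letters `S`, shifts `T₁, T₂` (symmetric), family `S + ηT₁ + η²T₂`; with `P, Q₁, Q₂` the three pencils and
`pol(X,Y) = det(X+Y) − det X − det Y`, `det(P + ηQ₁ + η²Q₂) = c₀ + ηc₁ + η²c₂ + η³c₃ + η⁴c₄`, `c₀ = det P`, `c₁ = pol(P,Q₁)`, `c₂ = pol(P,Q₂) + det Q₁`.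
Frame: 18 outer abscissae `τ` (at each, the first non-zero of `c₀, c₁, c₂` has the target sign `κ_j`; `κ` alternates except across the gap
`j⋆` containing `t⋆`).  Data at `t⋆`: `c₀` vanishes to order 4 with `c₀⁗(t⋆) = 24a`, `c₁(t⋆) = c₁′(t⋆) = 0`, `c₁″(t⋆) = 2A₁`, `c₂(t⋆) = e₀`, and
`aκ_{j⋆} > 0`, `ae₀ > 0`, some `σ₀ > 0` with `a·M(σ₀) < 0` for the SCALING POLYNOMIAL `M(σ) = aσ⁴ + A₁σ² + e₀` (exists iff `aA₁ < 0`, `A₁² > 4ae₀`).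
Conclusion: `δ ∈ TwentyLocus` — the quadruple zero opens into four simple zeros `t⋆ ± η^{1/2}ρ`, checked at `t⋆ − η^{1/2}σ₀, t⋆, t⋆ + η^{1/2}σ₀`.

WHAT IS HERE.  `det_add_smul_add_smul_fin_two` (the `η`-expansion of a `2 × 2` determinant), `expSum_add_coeff`, `eventually_kappa_pos_poly4`
(first non-zero coefficient decides the sign of `c₀ + ηc₁ + … + η⁴c₄` for small `η > 0`), ★ `mem_twentyLocus_of_quadZero`.
Nothing here bears on `DoorA26`, `DoorA34`, (W)/(M)/(R), `MatrixDescartes` (18050) or `VP ≠ VNP`; registers unchanged.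

[folklore] Newton polygon / Taylor.  [this work] the theorem.
-/

set_option linter.dupNamespace false

namespace Summit.ValiantsHypothesis.ValiantsHypothesis.Theorems.LacunarySymmetroidMatrixDescartes.WallBubbling

open Finset Filter Topology
open Bubbling (TwentyLocus expSum)

/-- The `η`-expansion of `det(A + ηB + η²C)` for `2 × 2` matrices. [folklore] -/
theorem det_add_smul_add_smul_fin_two (A B C : Matrix (Fin 2) (Fin 2) ℝ) (η : ℝ) :
    (A + η • B + η ^ 2 • C).det = A.det + η * ((A + B).det - A.det - B.det)
      + η ^ 2 * (((A + C).det - A.det - C.det) + B.det) + η ^ 3 * ((B + C).det - B.det - C.det) + η ^ 4 * C.det := by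
  simp only [Matrix.det_fin_two, Matrix.add_apply, Matrix.smul_apply, smul_eq_mul]
  ring

/-- Adding exponential sums with the same exponents adds the coefficients. [folklore] -/
theorem expSum_add_coeff {ι : Type*} [Fintype ι] (a b x : ι → ℝ) (t : ℝ) :
    expSum a x t + expSum b x t = expSum (fun i => a i + b i) x t := by
  unfold Bubbling.expSum
  rw [← Finset.sum_add_distrib]
  exact Finset.sum_congr rfl fun i _ => by ring

/-- The pencil of the family `S + ηT₁ + η²T₂` is `P + ηQ₁ + η²Q₂`. [folklore] -/
theorem expPencil_add_smul_add_smul (δ : Fin 6 → ℝ) (S T₁ T₂ : Fin 6 → Matrix (Fin 2) (Fin 2) ℝ) (η t : ℝ) :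
    (∑ l, Real.exp (δ l * t) • (S l + η • T₁ l + η ^ 2 • T₂ l))
      = (∑ l, Real.exp (δ l * t) • S l) + η • (∑ l, Real.exp (δ l * t) • T₁ l) + η ^ 2 • (∑ l, Real.exp (δ l * t) • T₂ l) := by
  simp only [smul_add, Finset.sum_add_distrib, Finset.smul_sum]
  congr 1
  · congr 1
    exact Finset.sum_congr rfl fun l _ => by rw [smul_comm]
  · exact Finset.sum_congr rfl fun l _ => by rw [smul_comm]

/-- **First non-zero coefficient decides**: for `D(η) = c₀ + ηc₁ + η²c₂ + η³c₃ + η⁴c₄`, if the first non-zero among `c₀, c₁, c₂` has sign `κ`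
then `κ D(η) > 0` for all small `η > 0`. [folklore] -/
theorem eventually_kappa_pos_poly4 (c0 c1 c2 c3 c4 κ : ℝ)
    (h : 0 < κ * c0 ∨ (c0 = 0 ∧ 0 < κ * c1) ∨ (c0 = 0 ∧ c1 = 0 ∧ 0 < κ * c2)) :
    ∀ᶠ η in 𝓝[>] (0 : ℝ), 0 < κ * (c0 + η * c1 + η ^ 2 * c2 + η ^ 3 * c3 + η ^ 4 * c4) := by
  have hpoly : ∀ (p : ℝ → ℝ), Continuous p → Tendsto p (𝓝[>] 0) (𝓝 (p 0)) :=
    fun p hp => (hp.tendsto 0).mono_left nhdsWithin_le_nhds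
  rcases h with h0 | ⟨h0, h1⟩ | ⟨h0, h1, h2⟩
  · have ht := hpoly (fun η => c0 + η * c1 + η ^ 2 * c2 + η ^ 3 * c3 + η ^ 4 * c4) (by fun_prop)
    have := eventually_kappa_pos_pow_mul 0 ht (by simpa using h0)
    simpa using this
  · have ht := hpoly (fun η => c1 + η * c2 + η ^ 2 * c3 + η ^ 3 * c4) (by fun_prop)
    have := eventually_kappa_pos_pow_mul 1 ht (by simpa using h1)
    refine this.mono fun η hη => ?_
    have e : c0 + η * c1 + η ^ 2 * c2 + η ^ 3 * c3 + η ^ 4 * c4 = η ^ 1 * (c1 + η * c2 + η ^ 2 * c3 + η ^ 3 * c4) := by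
      rw [h0]; ring
    rwa [e]
  · have ht := hpoly (fun η => c2 + η * c3 + η ^ 2 * c4) (by fun_prop)
    have := eventually_kappa_pos_pow_mul 2 ht (by simpa using h2)
    refine this.mono fun η hη => ?_
    have e : c0 + η * c1 + η ^ 2 * c2 + η ^ 3 * c3 + η ^ 4 * c4 = η ^ 2 * (c2 + η * c3 + η ^ 2 * c4) := by
      rw [h0, h1]; ring
    rwa [e]

/-- ★ **THE ORDER-4 OPENING THEOREM** (second-order family at a quadruple zero; see the module docstring for the reading). [this work] -/
theorem mem_twentyLocus_of_quadZero (δ : Fin 6 → ℝ) (S T₁ T₂ : Fin 6 → Matrix (Fin 2) (Fin 2) ℝ)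
    (hS : ∀ l, (S l).IsSymm) (hT₁ : ∀ l, (T₁ l).IsSymm) (hT₂ : ∀ l, (T₂ l).IsSymm)
    (τ : Fin 18 → ℝ) (hτ : StrictMono τ) (jstar : Fin 17) (tstar : ℝ)
    (ht1 : τ jstar.castSucc < tstar) (ht2 : tstar < τ jstar.succ)
    (κ : Fin 18 → ℝ) (halt : ∀ j : Fin 17, j ≠ jstar → κ j.castSucc * κ j.succ < 0)
    (hsame : 0 < κ jstar.castSucc * κ jstar.succ)
    (hout : ∀ j,
      0 < κ j * (∑ l, Real.exp (δ l * τ j) • S l).det ∨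
      ((∑ l, Real.exp (δ l * τ j) • S l).det = 0 ∧
        0 < κ j * (((∑ l, Real.exp (δ l * τ j) • S l) + (∑ l, Real.exp (δ l * τ j) • T₁ l)).det
              - (∑ l, Real.exp (δ l * τ j) • S l).det - (∑ l, Real.exp (δ l * τ j) • T₁ l).det)) ∨
      ((∑ l, Real.exp (δ l * τ j) • S l).det = 0 ∧
        ((∑ l, Real.exp (δ l * τ j) • S l) + (∑ l, Real.exp (δ l * τ j) • T₁ l)).det
              - (∑ l, Real.exp (δ l * τ j) • S l).det - (∑ l, Real.exp (δ l * τ j) • T₁ l).det = 0 ∧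
        0 < κ j * ((((∑ l, Real.exp (δ l * τ j) • S l) + (∑ l, Real.exp (δ l * τ j) • T₂ l)).det
              - (∑ l, Real.exp (δ l * τ j) • S l).det - (∑ l, Real.exp (δ l * τ j) • T₂ l).det)
              + (∑ l, Real.exp (δ l * τ j) • T₁ l).det)))
    (a A₁ e₀ σ₀ : ℝ) (haκ : 0 < a * κ jstar.castSucc)
    (hD0 : (∑ l, Real.exp (δ l * tstar) • S l).det = 0)
    (hD1 : deriv (fun t => (∑ l, Real.exp (δ l * t) • S l).det) tstar = 0)
    (hD2 : iteratedDeriv 2 (fun t => (∑ l, Real.exp (δ l * t) • S l).det) tstar = 0)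
    (hD3 : iteratedDeriv 3 (fun t => (∑ l, Real.exp (δ l * t) • S l).det) tstar = 0)
    (hD4 : iteratedDeriv 4 (fun t => (∑ l, Real.exp (δ l * t) • S l).det) tstar = 24 * a)
    (hB0 : ((∑ l, Real.exp (δ l * tstar) • S l) + (∑ l, Real.exp (δ l * tstar) • T₁ l)).det
              - (∑ l, Real.exp (δ l * tstar) • S l).det - (∑ l, Real.exp (δ l * tstar) • T₁ l).det = 0)
    (hB1 : deriv (fun t => ((∑ l, Real.exp (δ l * t) • S l) + (∑ l, Real.exp (δ l * t) • T₁ l)).det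
              - (∑ l, Real.exp (δ l * t) • S l).det - (∑ l, Real.exp (δ l * t) • T₁ l).det) tstar = 0)
    (hB2 : iteratedDeriv 2 (fun t => ((∑ l, Real.exp (δ l * t) • S l) + (∑ l, Real.exp (δ l * t) • T₁ l)).det
              - (∑ l, Real.exp (δ l * t) • S l).det - (∑ l, Real.exp (δ l * t) • T₁ l).det) tstar = 2 * A₁)
    (hC0 : (((∑ l, Real.exp (δ l * tstar) • S l) + (∑ l, Real.exp (δ l * tstar) • T₂ l)).det
              - (∑ l, Real.exp (δ l * tstar) • S l).det - (∑ l, Real.exp (δ l * tstar) • T₂ l).det)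
              + (∑ l, Real.exp (δ l * tstar) • T₁ l).det = e₀)
    (he : 0 < a * e₀) (hσ : 0 < σ₀) (hM : a * (a * σ₀ ^ 4 + A₁ * σ₀ ^ 2 + e₀) < 0) :
    δ ∈ TwentyLocus := by
  classical
  -- abbreviations for the three pencils
  set P : ℝ → Matrix (Fin 2) (Fin 2) ℝ := fun t => ∑ l, Real.exp (δ l * t) • S l with hP
  set Q₁ : ℝ → Matrix (Fin 2) (Fin 2) ℝ := fun t => ∑ l, Real.exp (δ l * t) • T₁ l with hQ₁
  set Q₂ : ℝ → Matrix (Fin 2) (Fin 2) ℝ := fun t => ∑ l, Real.exp (δ l * t) • T₂ l with hQ₂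
  -- the coefficient functions
  set c₀ : ℝ → ℝ := fun t => (P t).det with hc₀
  set c₁ : ℝ → ℝ := fun t => (P t + Q₁ t).det - (P t).det - (Q₁ t).det with hc₁
  set c₂ : ℝ → ℝ := fun t => ((P t + Q₂ t).det - (P t).det - (Q₂ t).det) + (Q₁ t).det with hc₂
  set c₃ : ℝ → ℝ := fun t => (Q₁ t + Q₂ t).det - (Q₁ t).det - (Q₂ t).det with hc₃
  set c₄ : ℝ → ℝ := fun t => (Q₂ t).det with hc₄
  -- the family and its determinant
  let Sη : ℝ → Fin 6 → Matrix (Fin 2) (Fin 2) ℝ := fun η l => S l + η • T₁ l + η ^ 2 • T₂ l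
  have hSη : ∀ η l, (Sη η l).IsSymm := fun η l => ((hS l).add ((hT₁ l).smul η)).add ((hT₂ l).smul (η ^ 2))
  have hdet : ∀ η t, (∑ l, Real.exp (δ l * t) • Sη η l).det
      = c₀ t + η * c₁ t + η ^ 2 * c₂ t + η ^ 3 * c₃ t + η ^ 4 * c₄ t := by
    intro η t
    show (∑ l, Real.exp (δ l * t) • (S l + η • T₁ l + η ^ 2 • T₂ l)).det = _
    rw [expPencil_add_smul_add_smul, det_add_smul_add_smul_fin_two]
  -- exponential-sum representations (Leibniz index)
  let ι := Equiv.Perm (Fin 2) × (Fin 2 → Fin 6)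
  let x : ι → ℝ := fun p => ∑ i, δ (p.2 i)
  let lb : (Fin 6 → Matrix (Fin 2) (Fin 2) ℝ) → ι → ℝ := fun U p => ((Equiv.Perm.sign p.1 : ℤ) : ℝ) * ∏ i, U (p.2 i) (p.1 i) i
  have hrep : ∀ U : Fin 6 → Matrix (Fin 2) (Fin 2) ℝ, (fun t => (∑ l, Real.exp (δ l * t) • U l).det) = expSum (lb U) x :=
    fun U => det_expPencil_eq_expSum_fun δ U
  have hPQ : ∀ (U V : Fin 6 → Matrix (Fin 2) (Fin 2) ℝ) (t : ℝ),
      (∑ l, Real.exp (δ l * t) • U l) + (∑ l, Real.exp (δ l * t) • V l) = ∑ l, Real.exp (δ l * t) • (U l + V l) :=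
    fun U V t => expPencil_add δ U V t
  -- c₀, c₁, c₂, c₃, c₄ as exponential sums
  let a0 : ι → ℝ := lb S
  let a1 : ι → ℝ := fun p => lb (fun l => S l + T₁ l) p - lb S p - lb T₁ p
  let a2 : ι → ℝ := fun p => (lb (fun l => S l + T₂ l) p - lb S p - lb T₂ p) + lb T₁ p
  let a3 : ι → ℝ := fun p => lb (fun l => T₁ l + T₂ l) p - lb T₁ p - lb T₂ p
  let a4 : ι → ℝ := lb T₂
  have ev : ∀ (U : Fin 6 → Matrix (Fin 2) (Fin 2) ℝ) (t : ℝ), (∑ l, Real.exp (δ l * t) • U l).det = expSum (lb U) x t :=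
    fun U t => congrFun (hrep U) t
  have hc₀f : c₀ = expSum a0 x := funext fun t => ev S t
  have hc₁f : c₁ = expSum a1 x := by
    funext t
    show (P t + Q₁ t).det - (P t).det - (Q₁ t).det = _
    rw [hP, hQ₁]; dsimp only
    rw [hPQ, ev, ev, ev, expSum_sub_sub]
  have hc₂f : c₂ = expSum a2 x := by
    funext t
    show ((P t + Q₂ t).det - (P t).det - (Q₂ t).det) + (Q₁ t).det = _
    rw [hP, hQ₁, hQ₂]; dsimp only
    rw [hPQ, ev, ev, ev, ev, expSum_sub_sub, expSum_add_coeff]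
  have hc₃f : c₃ = expSum a3 x := by
    funext t
    show (Q₁ t + Q₂ t).det - (Q₁ t).det - (Q₂ t).det = _
    rw [hQ₁, hQ₂]; dsimp only
    rw [hPQ, ev, ev, ev, expSum_sub_sub]
  have hc₄f : c₄ = expSum a4 x := funext fun t => ev T₂ t
  -- Taylor data as vanishing of the derivative sums
  have hmom : ∀ (b : ι → ℝ) (j : ℕ), expSum (fun i => b i * x i ^ j) x tstar = iteratedDeriv j (expSum b x) tstar :=
    fun b j => by rw [iteratedDeriv_expSum]
  have hD0' : iteratedDeriv 0 c₀ tstar = 0 := by rw [iteratedDeriv_zero]; exact hD0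
  have hD1' : iteratedDeriv 1 c₀ tstar = 0 := by rw [iteratedDeriv_one]; exact hD1
  have hB0' : iteratedDeriv 0 c₁ tstar = 0 := by rw [iteratedDeriv_zero]; exact hB0
  have hB1' : iteratedDeriv 1 c₁ tstar = 0 := by rw [iteratedDeriv_one]; exact hB1
  -- the five Taylor quotients
  have T0 : Tendsto (fun h => c₀ (tstar + h) / h ^ 4) (𝓝[≠] 0) (𝓝 a) := by
    have hv : ∀ j < 4, expSum (fun i => a0 i * x i ^ j) x tstar = 0 := by
      intro j hj
      rw [hmom, ← hc₀f]
      interval_cases j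
      · exact hD0'
      · exact hD1'
      · exact hD2
      · exact hD3
    have := tendsto_expSum_div_pow x tstar 4 a0 hv
    rw [hmom, ← hc₀f, hD4, show (Nat.factorial 4 : ℝ) = 24 by norm_num [Nat.factorial]] at this
    rw [hc₀f] at this ⊢
    convert this using 2; field_simp
  have T1 : Tendsto (fun h => c₁ (tstar + h) / h ^ 2) (𝓝[≠] 0) (𝓝 A₁) := by
    have hv : ∀ j < 2, expSum (fun i => a1 i * x i ^ j) x tstar = 0 := by
      intro j hj
      rw [hmom, ← hc₁f]
      interval_cases j
      · exact hB0'
      · exact hB1'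
    have := tendsto_expSum_div_pow x tstar 2 a1 hv
    rw [hmom, ← hc₁f, hB2, show (Nat.factorial 2 : ℝ) = 2 by norm_num [Nat.factorial]] at this
    rw [hc₁f] at this ⊢
    convert this using 2; field_simp
  have Tk0 : ∀ (b : ι → ℝ), Tendsto (fun h => expSum b x (tstar + h) / h ^ 0) (𝓝[≠] 0) (𝓝 (expSum b x tstar)) := by
    intro b
    have := tendsto_expSum_div_pow x tstar 0 b (fun j hj => absurd hj (Nat.not_lt_zero j))
    simpa using this
  have T2 : Tendsto (fun h => c₂ (tstar + h) / h ^ 0) (𝓝[≠] 0) (𝓝 e₀) := by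
    have := Tk0 a2; rw [← hc₂f] at this; rwa [← hC0]
  have T3 : Tendsto (fun h => c₃ (tstar + h) / h ^ 0) (𝓝[≠] 0) (𝓝 (c₃ tstar)) := by
    have := Tk0 a3; rwa [← hc₃f] at this
  have T4 : Tendsto (fun h => c₄ (tstar + h) / h ^ 0) (𝓝[≠] 0) (𝓝 (c₄ tstar)) := by
    have := Tk0 a4; rwa [← hc₄f] at this
  -- the scaling data on `Fin 5`
  let cc : Fin 5 → ℝ → ℝ := ![fun h => c₀ (tstar + h), fun h => c₁ (tstar + h), fun h => c₂ (tstar + h),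
    fun h => c₃ (tstar + h), fun h => c₄ (tstar + h)]
  let ee : Fin 5 → ℝ := ![0, 1, 2, 3, 4]
  let kk : Fin 5 → ℕ := ![4, 2, 0, 0, 0]
  let AA : Fin 5 → ℝ := ![a, A₁, e₀, c₃ tstar, c₄ tstar]
  have hcc : ∀ i, Tendsto (fun h => cc i h / h ^ (kk i)) (𝓝[≠] 0) (𝓝 (AA i)) := by
    intro i; fin_cases i
    · exact T0
    · exact T1
    · exact T2
    · exact T3
    · exact T4
  have hβ : ∀ i : Fin 5, (2 : ℝ) ≤ ee i + (1 / 2 : ℝ) * kk i := by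
    intro i; fin_cases i <;> simp [ee, kk] <;> norm_num
  have hMval : (∑ i : Fin 5, if ee i + (1 / 2 : ℝ) * kk i = 2 then AA i * σ₀ ^ (kk i) else 0)
      = a * σ₀ ^ 4 + A₁ * σ₀ ^ 2 + e₀ := by
    simp only [Fin.sum_univ_five, ee, kk, AA, Matrix.cons_val_zero, Matrix.cons_val_one, Matrix.head_cons,
      Matrix.cons_val_two, Matrix.tail_cons, Matrix.cons_val_three, Matrix.cons_val_four]
    norm_num
  have hMval' : (∑ i : Fin 5, if ee i + (1 / 2 : ℝ) * kk i = 2 then AA i * (-σ₀) ^ (kk i) else 0)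
      = a * σ₀ ^ 4 + A₁ * σ₀ ^ 2 + e₀ := by
    simp only [Fin.sum_univ_five, ee, kk, AA, Matrix.cons_val_zero, Matrix.cons_val_one, Matrix.head_cons,
      Matrix.cons_val_two, Matrix.tail_cons, Matrix.cons_val_three, Matrix.cons_val_four]
    norm_num [neg_pow]
  -- the determinant at a moving abscissa is the scaling sum
  have hsum : ∀ (η : ℝ) (σ : ℝ), 0 < η →
      (∑ i : Fin 5, η ^ (ee i) * cc i (η ^ (1 / 2 : ℝ) * σ)) = (∑ l, Real.exp (δ l * (tstar + η ^ (1 / 2 : ℝ) * σ)) • Sη η l).det := by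
    intro η σ hη
    rw [hdet, Fin.sum_univ_five]
    simp only [ee, cc, Matrix.cons_val_zero, Matrix.cons_val_one, Matrix.head_cons, Matrix.cons_val_two, Matrix.tail_cons,
      Matrix.cons_val_three, Matrix.cons_val_four]
    rw [Real.rpow_zero, show (1 : ℝ) = ((1 : ℕ) : ℝ) by norm_num, show (2 : ℝ) = ((2 : ℕ) : ℝ) by norm_num,
      show (3 : ℝ) = ((3 : ℕ) : ℝ) by norm_num, show (4 : ℝ) = ((4 : ℕ) : ℝ) by norm_num,
      Real.rpow_natCast, Real.rpow_natCast, Real.rpow_natCast, Real.rpow_natCast]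
    ring
  -- signs
  have hκM : 0 < -κ jstar.castSucc * (a * σ₀ ^ 4 + A₁ * σ₀ ^ 2 + e₀) := by
    by_contra h
    push Not at h
    nlinarith [mul_neg_of_pos_of_neg haκ hM, sq_nonneg a, h, mul_nonneg (sq_nonneg a) (neg_nonneg.2 h)]
  have hκe : 0 < κ jstar.castSucc * e₀ := by
    by_contra h
    push Not at h
    nlinarith [mul_pos haκ he, sq_nonneg a, h, mul_nonneg (sq_nonneg a) (neg_nonneg.2 h)]
  -- the width ε(η) = η^{1/2} σ₀
  have hεt : Tendsto (fun η : ℝ => η ^ (1 / 2 : ℝ) * σ₀) (𝓝[>] 0) (𝓝 0) := by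
    have := (tendsto_rpow_nhdsGT_zero (by norm_num : (0 : ℝ) < 1 / 2)).mul_const σ₀
    simpa using this
  have hεpos : ∀ᶠ η in 𝓝[>] (0 : ℝ), 0 < η ^ (1 / 2 : ℝ) * σ₀ := by
    filter_upwards [self_mem_nhdsWithin] with η hη
    exact mul_pos (Real.rpow_pos_of_pos hη _) hσ
  refine mem_twentyLocus_of_insert_three δ Sη hSη τ hτ jstar tstar ht1 ht2 (fun η => η ^ (1 / 2 : ℝ) * σ₀) hεt hεpos κ halt hsame
    ?_ ?_ ?_ ?_
  · -- outer abscissae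
    intro j
    have := eventually_kappa_pos_poly4 (c₀ (τ j)) (c₁ (τ j)) (c₂ (τ j)) (c₃ (τ j)) (c₄ (τ j)) (κ j) (hout j)
    exact this.mono fun η hη => by rw [hdet]; exact hη
  · -- t⋆ − η^{1/2}σ₀
    have h := eventually_kappa_pos_scaling cc ee kk AA (by norm_num : (0 : ℝ) < 1 / 2) (neg_ne_zero.2 hσ.ne') hcc 2 hβ
      (-κ jstar.castSucc) (by rw [hMval']; exact hκM)
    filter_upwards [h, self_mem_nhdsWithin] with η hη hη0
    rw [hsum η (-σ₀) hη0] at hη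
    have e : tstar + η ^ (1 / 2 : ℝ) * -σ₀ = tstar - η ^ (1 / 2 : ℝ) * σ₀ := by ring
    rwa [e] at hη
  · -- t⋆
    have := eventually_kappa_pos_poly4 (c₀ tstar) (c₁ tstar) (c₂ tstar) (c₃ tstar) (c₄ tstar) (κ jstar.castSucc)
      (Or.inr (Or.inr ⟨hD0, hB0, by rw [show c₂ tstar = e₀ from hC0]; exact hκe⟩))
    exact this.mono fun η hη => by rw [hdet]; exact hη
  · -- t⋆ + η^{1/2}σ₀
    have h := eventually_kappa_pos_scaling cc ee kk AA (by norm_num : (0 : ℝ) < 1 / 2) hσ.ne' hcc 2 hβ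
      (-κ jstar.castSucc) (by rw [hMval]; exact hκM)
    filter_upwards [h, self_mem_nhdsWithin] with η hη hη0
    rwa [hsum η σ₀ hη0] at hη

end Summit.ValiantsHypothesis.ValiantsHypothesis.Theorems.LacunarySymmetroidMatrixDescartes.WallBubbling
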